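import Summits.HodgeConjecture.CorCM.MumfordTateRankCMSurfaceTimesTypeIV
import Summits.HodgeConjecture.CorCM.MumfordTateRankRigidMonotone
import HarnessLib

/-!
# A SIMPLE CM abelian SURFACE is `Θ`-rigid: `Lie Hg(H¹S)` is the smallest bracket-closed rational subspace whose complexification contains
# a Hodge operator — and the rigid-factor monotonicity `t(S × X₂) ≥ t(S)` (Moonen–Zarhin 1999 (2.2): primitive quartic CM types)

COR-CM (cell `pub-hodgecm2`, seat `b27` gen 49, count-neutral Mumford–Tate-rank ladder; theorems only, no definition, no named fact;
UNCONDITIONAL — nothing here uses or asserts HC_CM).  Notation `t(X) = dim MT(H¹X)`.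

The `c = 0` case of the twisted rigidity `RankFourCM.hodgeLie_le_of_theta_sub_smul_mem_spanC` (`Motives/HodgeLieRankFourTwistedRigidity`):
for `S` a simple abelian surface of CM type, a rational subspace `𝔞 ⊆ Lie Hg(H¹S)` whose complex span contains a Hodge operator `Θ` is all of
`Lie Hg(H¹S)` (the CM type of `S` is primitive, so `Θ ∈ F ⊗ ℂ` lies on no proper rational subspace of `F⁻ = Lie U_F`).  This is the
`Θ`-RIGIDITY predicate of `CorCM/MumfordTateRankRigidMonotone` (gen 48), whence the restriction `Lie Hg(H¹(S × X₂)) → Lie Hg(H¹S)` is onto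
(`hodgeLie_eq_map_restrict_of_rigid`) and `t(S × X₂) ≥ t(S)` for every `X₂`.

* **`hodgeLie_rigid_of_isSimple_cmSurface`** — the rigidity predicate for `H¹S`, `S` a simple CM surface;
* `mtRank_hodge_one_le_of_isIsogenous_cmSurface_prod` — `t(S) ≤ t(X)` for `X ∼ S × X₂` (so `3 ≤ t(X)`).

## References
* [MoonenZarhin1999LowDim] B. Moonen, Yu. G. Zarhin, *Hodge classes on abelian varieties of low dimension*, Math. Ann. 315 (1999), §2 (2.2), §3,
  (5.6) [corpus: paper:arxiv-math_9901113 pp. 5–7, 10]. [cite: MoonenZarhin1999LowDim, §2 (2.2) and (5.6)]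
* [Shimura1998] G. Shimura, *Abelian Varieties with Complex Multiplication and Modular Functions*, §8.4 Example (2). [cite: Shimura1998, §8.4 Example (2)]
-/

noncomputable section

open scoped TensorProduct
open CategoryTheory CategoryTheory.Limits Module

namespace Summit.HodgeConjecture.CorCM

open Literature.AlgebraicGeometry.Motives
open Literature.AlgebraicGeometry.Motives.AbelianVariety
open Literature.AlgebraicGeometry.Motives.HodgeStructure
open Literature.AlgebraicGeometry.HodgeTheory
open Literature.AlgebraicGeometry.Milne1999 (IsOfCMType)

variable [HodgeTensorFacts.{0, 0}] {X S : AbelianVariety ℂ} {n k : ℕ}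

/-- **A simple CM abelian surface is `Θ`-rigid**: every rational subspace `𝔞 ⊆ Lie Hg(H¹S)` whose complex span contains a Hodge operator
is all of `Lie Hg(H¹S)` (the bracket-closure hypothesis of the rigidity predicate is not even needed: `Lie Hg(H¹S)` is abelian).  The `c = 0` case
of the twisted rigidity of `Motives/HodgeLieRankFourTwistedRigidity`, with the Hodge data of `endAlg_hodge_one_data_of_isSimple_cmSurface`.
[cite: MoonenZarhin1999LowDim, §2 (2.2) and (5.6)] [cite: Shimura1998, §8.4 Example (2)] -/
theorem hodgeLie_rigid_of_isSimple_cmSurface (hS : IsSmoothProjective k S.X) (hSs : S.IsSimple) (hS2 : S.dim = 2) (hScm : IsOfCMType S) :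
    haveI := BettiUniverse.finite hS 1
    ∀ 𝔞 : Submodule ℚ (Module.End ℚ (bettiCohomology S.X 1)),
      𝔞 ≤ (BettiUniverse.hodge exists_isReal_hodgeModel_holds hS 1).hodgeLie →
      (∀ B ∈ 𝔞, ∀ B' ∈ 𝔞, B * B' - B' * B ∈ 𝔞) →
      (∃ Θ ∈ Submodule.span ℂ ((fun B : Module.End ℚ (bettiCohomology S.X 1) => B.baseChange ℂ) ''
          (𝔞 : Set (Module.End ℚ (bettiCohomology S.X 1)))),
        ∀ p, ∀ x ∈ (BettiUniverse.hodge exists_isReal_hodgeModel_holds hS 1).piece p (((1 : ℕ) : ℤ) - p),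
          Θ x = ((2 * p - ((1 : ℕ) : ℤ) : ℤ) : ℂ) • x) →
      (BettiUniverse.hodge exists_isReal_hodgeModel_holds hS 1).hodgeLie ≤ 𝔞 := by
  classical
  have hkS : S.dim = k := schemeDim_eq_holds hS
  subst hkS
  haveI := BettiUniverse.finite hS 1
  intro 𝔞 hle _ hΘ
  obtain ⟨Θ, hΘ𝔞, hΘ⟩ := hΘ
  obtain ⟨hcommE, hinvE, hE4, h𝔥2⟩ := endAlg_hodge_one_data_of_isSimple_cmSurface hS hSs hS2 hScm
  obtain ⟨ψ⟩ := BettiUniverse.hodge_isPolarizable exists_isReal_hodgeModel_holds hS 1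
  have heff := BettiUniverse.hodge_isEffective exists_isReal_hodgeModel_holds hS 1
  have hV : Module.finrank ℚ (bettiCohomology S.X 1) = 4 := by rw [finrank_bettiCohomology_one S, hS2]
  have hmem : Θ - (0 : ℂ) • (0 : Module.End ℚ (bettiCohomology S.X 1)).baseChange ℂ ∈ spanC 𝔞 := by
    rw [zero_smul, sub_zero]
    exact hΘ𝔞
  exact RankFourCM.hodgeLie_le_of_theta_sub_smul_mem_spanC (BettiUniverse.hodge exists_isReal_hodgeModel_holds hS 1) Nat.cast_one heff ψ hΘ
    hV hcommE hinvE hE4 h𝔥2 (Submodule.zero_mem _) 𝔞 hle (q := 0) (by rw [Rat.cast_zero, mul_zero]) hmem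

/-- **`t(S) ≤ t(X)` for every `X ∼ S × X₂` with `S` a simple CM abelian surface** (rigid-factor monotonicity, `CorCM/MumfordTateRankRigidMonotone`;
`t(S) = 3`). [cite: MoonenZarhin1999LowDim, §3 (3.1) and (5.6)] -/
theorem mtRank_hodge_one_le_of_isIsogenous_cmSurface_prod (hX : IsSmoothProjective n X.X) (hS : IsSmoothProjective k S.X) (hSs : S.IsSimple)
    (hS2 : S.dim = 2) (hScm : IsOfCMType S) {X₂ : AbelianVariety ℂ} (hXP : IsIsogenous X (S.prod X₂)) :
    haveI := BettiUniverse.finite hX 1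
    haveI := BettiUniverse.finite hS 1
    (BettiUniverse.hodge exists_isReal_hodgeModel_holds hS 1).mtRank ≤ (BettiUniverse.hodge exists_isReal_hodgeModel_holds hX 1).mtRank :=
  mtRank_hodge_one_le_of_isIsogenous_prod_of_rigid hX hS (by omega) (hodgeLie_rigid_of_isSimple_cmSurface hS hSs hS2 hScm) hXP

end Summit.HodgeConjecture.CorCM

end
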